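import Literature.Analysis.FluidPDE.TorusLinearisedNSVDataExistence
import Summits.AnomalousDissipation.AnomalousDissipation.Theorems.BaireTransferDenseLoudDesignerForcesErgodicLine

/-!
# Solutions of the linearised NS_ν equation on `T³` from `V`-data, classical on `(a, a + L]`,
# attaining the datum in `H¹` (line `ergodic-budget-selection-closing`, crux
# `BaireTransfer.DenseLoudDesignerForces`, stmt-AnomalousDissipation-1143) — tools stub L2 of block N

Sorry-free Summit-side corollary of the landed Literature theorem
`Torus.linearisedNS_exists_of_eGradNormSq_ne_top`
(`Literature/Analysis/FluidPDE/TorusLinearisedNSVDataExistence.lean`): block N of the line linearises the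
NS_ν(f_c) semiflow along the trajectories of its smooth model, and the derivative cocycle acts on
`V`-data (`H¹`, not smooth); this file constructs the corresponding classical solutions of the
linearised equation (`IsLinearizedNSSolutionOn` of `…ErgodicLine`, §2) for the phase space `H` of the
line (`Hsp`, `rep`).

* `stub_linearisedVDataExistenceTools` (the registered tools stub L2, CORRECTED by a uniform Gevrey
  hypothesis on the background) — for `ν > 0`, `L > 0`, a background `u` jointly smooth on
  `[a, a + L] × T³` with divergence-free mean-zero slices and a uniform Gevrey bound
  `∑_{k∈S} e^{2σ₀|k|}‖û(t, k)‖² ≤ C₀` (`σ₀ > 0`), there is `C` such that every state `v₀ ∈ H` of finite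
  enstrophy is attained in `L²` and in `Ḣ¹` as `t → a⁺` by a solution `(w, q)` of the linearised
  equation along `u`, classical on `(a, a + L]`, with
  `∫ ‖w(t)‖² + ‖∇w(t)‖₂² ≤ C(∫ ‖v₀‖² + ‖∇v₀‖₂²)`.

The Gevrey hypothesis replaces `H^k` smoothing estimates of all orders for the linearised flow along a
merely smooth background (not in the tree); it is the hypothesis of the linear Foias–Temam smoothing
estimate `Torus.linearisedNS_gevrey_of_gevreyBound`, and the backgrounds of the application — classical
NS_ν(f_c) trajectories in a compact invariant set, after a time lapse — satisfy it
(`Torus.IsClassicalNSSolutionOn.gevrey_of_gradNormSq_le`).  References: P. Constantin, C. Foias,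
*Navier–Stokes Equations* (1988), Ch. 14, (14.2)–(14.4), Lemma 14.3 (the linearised equation along a
trajectory); C. Foias, R. Temam, JFA 87 (1989), Thm 1.1.  Nothing is asserted; no definition is added.
-/

-- `Summit.<Summit>.<Problem>` is the tree's mandated summit-side namespace (CONVENTIONS §2); for this
-- single-conjunct summit the two coincide, so the duplicate is deliberate.
set_option linter.dupNamespace false

noncomputable section

open Set Function MeasureTheory Filter
open scoped InnerProductSpace Topology ENNReal

namespace Summit.AnomalousDissipation.AnomalousDissipation.Theorems.DenseLoudDesignerForces.Ergodic

open Literature.Analysis.FunctionSpaces Literature.Analysis.FunctionSpaces.Torus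
open Literature.Analysis.FluidPDE Literature.Analysis.FluidPDE.Torus

/-- **Tools stub L2 (`stub_linearisedVDataExistenceTools`, with a uniform Gevrey hypothesis on the
background) — solutions of the linearised Navier–Stokes equation on `T³` from `V`-data** (Constantin–Foias
1988, Ch. 14, (14.2)–(14.4) with Lemma 14.3, by smooth approximation).  For `ν > 0`, `L > 0`, `u` jointly
smooth on `[a, a + L] × T³` with divergence-free mean-zero slices and
`∑_{k∈S} e^{2σ₀|k|}‖𝓕(u t)(k)‖² ≤ C₀` (`σ₀ > 0`, all `t ∈ [a, a + L]`, all finite `S`), there is `C` such that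
for every state `v₀ ∈ H` with `eGradNormSq (rep v₀) ≠ ⊤` there is a solution `(w, q)` of the linearised
equation along `u` in the sense of `IsLinearizedNSSolutionOn (Ioc a (a + L))` with
`∫ ‖w(t)‖² + ‖∇w(t)‖₂² ≤ C(∫ ‖rep v₀‖² + (eGradNormSq (rep v₀)).toReal)` on `(a, a + L]`,
`∫ ‖w(t) − rep v₀‖² → 0` and `eGradNormSq (w(t) − rep v₀) → 0` as `t → a⁺`.  Proof: the Literature theorem
at `d = Fin 3`; a state of `H` is represented by an `L²`, weakly divergence-free, mean-zero field
(`Lp.memLp`, `Torus.isWeaklyDivFree_of_mem_energySpace`, `Torus.integral_eq_zero_of_mem_energySpace`).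
The zero mean of the background is not needed (it is carried for the registered shape).
[cite: ConstantinFoiasNSE1988, Ch. 14 (14.2)–(14.4), Lemma 14.3] -/
theorem stub_linearisedVDataExistenceTools {ν : ℝ} (hν : 0 < ν) {a L : ℝ} (hL : 0 < L)
    {u : ℝ → (UnitAddTorus (Fin 3)) → (EuclideanSpace ℝ (Fin 3))} (hu : IsSmoothSpaceTimeOn (Icc a (a + L)) u)
    (hudiv : ∀ t ∈ Icc a (a + L), IsDivFree (u t)) (humean : ∀ t ∈ Icc a (a + L), HasZeroMean (u t))
    {σ₀ C₀ : ℝ} (hσ₀ : 0 < σ₀)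
    (hGev : ∀ t ∈ Icc a (a + L), ∀ S : Finset (Fin 3 → ℤ),
      ∑ k ∈ S, Real.exp (2 * σ₀ * Real.sqrt (freqNormSq k)) *
        ‖UnitAddTorus.mFourierCoeff (EuclideanSpace.complexify ∘ u t) k‖ ^ 2 ≤ C₀) :
    ∃ C : ℝ, ∀ v₀ : Hsp, eGradNormSq (rep v₀) ≠ ⊤ →
      ∃ (w : ℝ → (UnitAddTorus (Fin 3)) → (EuclideanSpace ℝ (Fin 3))) (q : ℝ → (UnitAddTorus (Fin 3)) → ℝ),
        IsLinearizedNSSolutionOn (Ioc a (a + L)) ν u w q ∧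
        (∀ t ∈ Ioc a (a + L), (∫ x, ‖w t x‖ ^ 2) + gradNormSq (w t) ≤ C * ((∫ x, ‖rep v₀ x‖ ^ 2) + (eGradNormSq (rep v₀)).toReal)) ∧
        Tendsto (fun t => ∫ x, ‖w t x - rep v₀ x‖ ^ 2) (𝓝[>] a) (𝓝 0) ∧
        Tendsto (fun t => eGradNormSq (w t - rep v₀)) (𝓝[>] a) (𝓝 0) := by
  -- the registered shape carries the zero mean of the background, which the Literature theorem does not need
  have _ : ∀ t ∈ Icc a (a + L), HasZeroMean (u t) := humean
  have hab : a < a + L := by linarith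
  obtain ⟨C, h⟩ := linearisedNS_exists_of_eGradNormSq_ne_top hν hσ₀ hab hu hudiv hGev
  refine ⟨C, fun v₀ hv₀ => ?_⟩
  obtain ⟨w, q, hws, hqs, hdiv, hmean, hleq, -, hbd, hL2, hH1⟩ := h (rep v₀) (Lp.memLp v₀.1)
    (isWeaklyDivFree_of_mem_energySpace v₀.2) (integral_eq_zero_of_mem_energySpace v₀.2) hv₀
  exact ⟨w, q, ⟨hws, hqs, hdiv, hmean, hleq⟩, hbd, hL2, hH1⟩

end Summit.AnomalousDissipation.AnomalousDissipation.Theorems.DenseLoudDesignerForces.Ergodic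

end
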